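import Mathlib
import HarnessLib
import Summits.HubbardSuperconductivity.HubbardSuperconductivity.Theorems.KLProgrammeKLRegimeSplitSlotsV17F2

/-!
# Route `KLProgramme` — ENGINE item stmt-HubbardSuperconductivity-20437, GAP G-005 «(C)-TADPOLE-NONVANISHING»: the GENERIC PLUMBING HALF
# (cell gate-hubbard-kl, seat p2 g27; pen (R426)(B)(3) / (R431)(B))

WHAT.  G-005 asks for `∃ q : Momentum, evalM (klFlowPiece L M β U μ 0) q ≠ 0` (the antecedent of `hresGuard_gfr_row_of_tadpole`, ✓ p715417).  By definition
`klFlowPiece … 0 = jacksonFrame (klFlowDeg 0) (klFrameExtFn μ (fun θ => klLocalPart L M β U μ K₀ 0 θ))` with `K₀ = klFlowFrameU … 0 = 0`, and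
`jacksonFrame d F = ⟨2d, fun k l => ĵ_k·ĵ_l·A_F(k,l)⟩` (`ĵ = jkerCoeff d`, `A_F = cosMoment F`).  This file proves the model-free algebra:
* `integral_cos_natMul_neg_pi_pi` — `∫_{−π}^{π} cos(k s) ds = if k = 0 then 2π else 0`;
* `jkerCoeff_zero_eq` — `ĵ_0 = 1/(2π)` (mass one of the periodic Jackson kernel, `integral_jker`);
* `cosMoment_eval_zero_zero` — for EVERY `K : TrigPolyC4v`, the torus mean of its evaluation is `(2π)²·κ_{0,0}` (orthogonality of the symmetrised harmonics);
* **`exists_evalM_jacksonFrame_ne_zero`** — `cosMoment F 0 0 ≠ 0 → ∃ q, evalM (jacksonFrame d F) q ≠ 0` (the `(0,0)` coefficient of the Jackson frame is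
  `A_F(0,0)/(2π)²`; a `C₄ᵥ` cosine polynomial with nonzero constant coefficient is not the zero function);
* **`exists_evalM_klFlowPiece_zero_ne_zero`** — the G-005 shape: `cosMoment (klFrameExtFn μ (fun θ => klLocalPart L M β U μ 0 0 θ)) 0 0 ≠ 0 →
  ∃ q, evalM (klFlowPiece L M β U μ 0) q ≠ 0`.
So G-005 is reduced to ONE number: the TORUS MEAN of the tube extension of the scale-0 local part is nonzero (owner: the scale-0 lane — its reduction to the
`(βL²)⁻¹·Σ_k T_k` form + `MatsubaraTadpole.sum_uvTadpole_ge`, ✓ p717470).  Pure real analysis on landed definitions; nothing here asserts G-005, any row of 20437, K3,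
the Kohn–Luttinger margin or superconductivity.  0 kit · 0 lit.  References: BGM 2006 §3 (3.2)–(3.3) [cite: BenfattoGiulianiMastropietro2006].
-/

noncomputable section

namespace Summit.HubbardSuperconductivity.HubbardSuperconductivity.Theorems.EngineV8

set_option linter.dupNamespace false -- summit = problem name (single-conjunct summit), D-0017

open Real Finset MeasureTheory intervalIntegral Literature.MathematicalPhysics.QuantumLattice Literature.Probability.LatticeModels
open Summit.HubbardSuperconductivity.HubbardSuperconductivity.Theorems.KLRegimeSplit
open Summit.HubbardSuperconductivity.HubbardSuperconductivity.Theorems.KLProgrammeLegKernels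
open Summit.HubbardSuperconductivity.HubbardSuperconductivity.Theorems.DispersionFlow

/-! ## §1 One-dimensional cosine integrals over a period -/

/-- `∫_{−π}^{π} cos(k·s) ds = 2π` for `k = 0` and `0` for `k ≥ 1`. [cite: BenfattoGiulianiMastropietro2006, §3 (3.2)] -/
theorem integral_cos_natMul_neg_pi_pi (k : ℕ) :
    ∫ s in (-π)..π, Real.cos ((k : ℝ) * s) = if k = 0 then 2 * π else 0 := by
  rcases Nat.eq_zero_or_pos k with rfl | hk
  · simp; ring
  · have hk0 : ((k : ℕ) : ℝ) ≠ 0 := by exact_mod_cast hk.ne'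
    rw [if_neg hk.ne', intervalIntegral.integral_comp_mul_left (fun x => Real.cos x) hk0, integral_cos]
    have h1 : Real.sin ((k : ℝ) * π) = 0 := Real.sin_nat_mul_pi k
    have h2 : Real.sin ((k : ℝ) * -π) = 0 := by rw [mul_neg, Real.sin_neg, h1, neg_zero]
    rw [h1, h2]; simp

/-- The indicator shorthand `I k := ∫_{−π}^{π} cos(k·s) ds`. -/
private theorem integral_cos_natMul_eq_ite (k : ℕ) :
    ∫ s in (-π)..π, Real.cos ((k : ℝ) * s) = if k = 0 then 2 * π else 0 := integral_cos_natMul_neg_pi_pi k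

/-! ## §2 The Jackson kernel's constant coefficient -/

/-- **`ĵ_0 = 1/(2π)`**: the constant cosine coefficient of the `2π`-periodic Jackson kernel (mass one, `integral_jker`).
[cite: BenfattoGiulianiMastropietro2006, §3 (3.2)] -/
theorem jkerCoeff_zero_eq (d : ℕ) : jkerCoeff d 0 = 1 / (2 * π) := by
  have h := integral_jker d
  have hint : ∀ m ∈ range (d + d + 1), IntervalIntegrable (fun s => jkerCoeff d m * Real.cos ((m : ℝ) * s)) volume (-π) π :=
    fun m _ => (continuous_const.mul (Real.continuous_cos.comp (continuous_const.mul continuous_id))).intervalIntegrable _ _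
  have h' : ∫ s in (-π)..π, jker d s = ∑ m ∈ range (d + d + 1), jkerCoeff d m * ∫ s in (-π)..π, Real.cos ((m : ℝ) * s) := by
    rw [show (fun s => jker d s) = fun s => ∑ m ∈ range (d + d + 1), jkerCoeff d m * Real.cos ((m : ℝ) * s) from
      funext fun s => jker_eq_cosPoly d s]
    rw [intervalIntegral.integral_finsetSum hint]
    exact Finset.sum_congr rfl fun m _ => intervalIntegral.integral_const_mul _ _
  rw [h'] at h
  simp_rw [integral_cos_natMul_eq_ite, mul_ite, mul_zero] at h
  rw [Finset.sum_ite_eq' (range (d + d + 1)) 0 (fun m => jkerCoeff d m * (2 * π)), if_pos (by simp)] at h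
  have hπ : (2 * π : ℝ) ≠ 0 := by positivity
  field_simp
  linarith

/-! ## §3 The torus mean of a `C₄ᵥ` cosine polynomial -/

/-- The inner `u`-integral of the symmetrised harmonic `h_{m,n}(s,u)`. [cite: BenfattoGiulianiMastropietro2006, §3 (3.2)] -/
theorem integral_harmonic_snd (m n : ℕ) (s : ℝ) :
    ∫ u in (-π)..π, TrigPolyC4v.harmonic m n ![s, u] =
      (Real.cos ((m : ℝ) * s) * (if n = 0 then 2 * π else 0) + Real.cos ((n : ℝ) * s) * (if m = 0 then 2 * π else 0)) / 2 := by
  simp only [TrigPolyC4v.harmonic, Matrix.cons_val_zero, Matrix.cons_val_one]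
  rw [intervalIntegral.integral_div, intervalIntegral.integral_add, intervalIntegral.integral_const_mul, intervalIntegral.integral_const_mul,
    integral_cos_natMul_eq_ite, integral_cos_natMul_eq_ite]
  · exact (continuous_const.mul (Real.continuous_cos.comp (continuous_const.mul continuous_id))).intervalIntegrable _ _
  · exact (continuous_const.mul (Real.continuous_cos.comp (continuous_const.mul continuous_id))).intervalIntegrable _ _

/-- The full torus integral of the symmetrised harmonic: `(2π)²` at `(0,0)`, zero otherwise. [cite: BenfattoGiulianiMastropietro2006, §3 (3.2)] -/
theorem integral_integral_harmonic (m n : ℕ) :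
    ∫ s in (-π)..π, ∫ u in (-π)..π, TrigPolyC4v.harmonic m n ![s, u] = if m = 0 ∧ n = 0 then (2 * π) ^ 2 else 0 := by
  simp_rw [integral_harmonic_snd]
  rw [intervalIntegral.integral_div, intervalIntegral.integral_add, intervalIntegral.integral_mul_const, intervalIntegral.integral_mul_const,
    integral_cos_natMul_eq_ite, integral_cos_natMul_eq_ite]
  · by_cases hm : m = 0
    · by_cases hn : n = 0
      · simp [hm, hn]; ring
      · simp [hm, hn]
    · by_cases hn : n = 0
      · simp [hm, hn]
      · simp [hm, hn]
  · exact ((Real.continuous_cos.comp (continuous_const.mul continuous_id)).mul continuous_const).intervalIntegrable _ _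
  · exact ((Real.continuous_cos.comp (continuous_const.mul continuous_id)).mul continuous_const).intervalIntegrable _ _

/-- **The torus mean of a `C₄ᵥ` cosine polynomial is its constant coefficient**: `A_{K}(0,0) = ∫∫ K = (2π)²·κ_{0,0}` for every `K : TrigPolyC4v`.
[cite: BenfattoGiulianiMastropietro2006, §3 (3.2)] -/
theorem cosMoment_eval_zero_zero (K : TrigPolyC4v) :
    cosMoment (fun p => K.eval p) 0 0 = (2 * π) ^ 2 * K.coeff 0 0 := by
  unfold cosMoment
  simp only [Nat.cast_zero, zero_mul, Real.cos_zero, one_mul]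
  -- the continuity of each term (in `u`, and of the inner integral in `s`)
  have hcu : ∀ (m n : ℕ) (s : ℝ), Continuous fun u : ℝ => K.coeff m n * TrigPolyC4v.harmonic m n ![s, u] := by
    intro m n s
    refine continuous_const.mul ?_
    simp only [TrigPolyC4v.harmonic, Matrix.cons_val_zero, Matrix.cons_val_one]
    fun_prop
  -- inner integral
  have hinner : ∀ s, ∫ u in (-π)..π, K.eval ![s, u] =
      ∑ m ∈ range (K.degree + 1), ∑ n ∈ range (K.degree + 1), K.coeff m n *
        ((Real.cos ((m : ℝ) * s) * (if n = 0 then 2 * π else 0) + Real.cos ((n : ℝ) * s) * (if m = 0 then 2 * π else 0)) / 2) := by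
    intro s
    simp only [TrigPolyC4v.eval_def]
    rw [intervalIntegral.integral_finsetSum (fun m _ => (continuous_finsetSum _ fun n _ => hcu m n s).intervalIntegrable _ _)]
    refine Finset.sum_congr rfl fun m _ => ?_
    rw [intervalIntegral.integral_finsetSum (fun n _ => (hcu m n s).intervalIntegrable _ _)]
    refine Finset.sum_congr rfl fun n _ => ?_
    rw [intervalIntegral.integral_const_mul, integral_harmonic_snd]
  simp_rw [hinner]
  -- outer integral
  have hcs : ∀ m n : ℕ, Continuous fun s : ℝ => K.coeff m n *
      ((Real.cos ((m : ℝ) * s) * (if n = 0 then 2 * π else 0) + Real.cos ((n : ℝ) * s) * (if m = 0 then 2 * π else 0)) / 2) := by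
    intro m n; fun_prop
  rw [intervalIntegral.integral_finsetSum (fun m _ => (continuous_finsetSum _ fun n _ => hcs m n).intervalIntegrable _ _)]
  have hterm : ∀ m n : ℕ, ∫ s in (-π)..π, K.coeff m n *
      ((Real.cos ((m : ℝ) * s) * (if n = 0 then 2 * π else 0) + Real.cos ((n : ℝ) * s) * (if m = 0 then 2 * π else 0)) / 2) =
      K.coeff m n * (if m = 0 ∧ n = 0 then (2 * π) ^ 2 else 0) := by
    intro m n
    rw [intervalIntegral.integral_const_mul, ← integral_integral_harmonic]
    simp_rw [integral_harmonic_snd]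
  have hrow : ∀ m ∈ range (K.degree + 1), ∫ s in (-π)..π, ∑ n ∈ range (K.degree + 1), K.coeff m n *
      ((Real.cos ((m : ℝ) * s) * (if n = 0 then 2 * π else 0) + Real.cos ((n : ℝ) * s) * (if m = 0 then 2 * π else 0)) / 2) =
      ∑ n ∈ range (K.degree + 1), K.coeff m n * (if m = 0 ∧ n = 0 then (2 * π) ^ 2 else 0) := by
    intro m _
    rw [intervalIntegral.integral_finsetSum (fun n _ => (hcs m n).intervalIntegrable _ _)]
    exact Finset.sum_congr rfl fun n _ => hterm m n
  rw [Finset.sum_congr rfl hrow]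
  -- only `(0,0)` survives
  rw [Finset.sum_eq_single 0, Finset.sum_eq_single 0]
  · simp
    ring
  · intro n _ hn; simp [hn]
  · intro h; exact absurd (Finset.mem_range.2 (Nat.succ_pos _)) h
  · intro m _ hm
    exact Finset.sum_eq_zero fun n _ => by simp [hm]
  · intro h; exact absurd (Finset.mem_range.2 (Nat.succ_pos _)) h

/-! ## §4 Non-vanishing of the Jackson frame -/

/-- The `(0,0)` coefficient of the Jackson frame: `ĵ_0²·A_F(0,0) = A_F(0,0)/(2π)²`. [cite: BenfattoGiulianiMastropietro2006, §3 (3.2)] -/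
theorem jacksonFrame_coeff_zero_zero (d : ℕ) (F : (Fin 2 → ℝ) → ℝ) :
    (jacksonFrame d F).coeff 0 0 = (1 / (2 * π)) ^ 2 * cosMoment F 0 0 := by
  show jkerCoeff d 0 * jkerCoeff d 0 * cosMoment F 0 0 = _
  rw [jkerCoeff_zero_eq]; ring

/-- **A Jackson frame with nonzero torus mean of `F` is not the zero function** (on `Fin 2 → ℝ`). [cite: BenfattoGiulianiMastropietro2006, §3 (3.2)] -/
theorem exists_eval_jacksonFrame_ne_zero {d : ℕ} {F : (Fin 2 → ℝ) → ℝ} (hF : cosMoment F 0 0 ≠ 0) :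
    ∃ p : Fin 2 → ℝ, (jacksonFrame d F).eval p ≠ 0 := by
  by_contra h
  push Not at h
  have h0 : cosMoment (fun p => (jacksonFrame d F).eval p) 0 0 = 0 := by
    have : (fun p => (jacksonFrame d F).eval p) = fun _ => 0 := funext h
    rw [this]; simp [cosMoment]
  rw [cosMoment_eval_zero_zero, jacksonFrame_coeff_zero_zero] at h0
  have hπ : (0 : ℝ) < 2 * π := by positivity
  have : (2 * π) ^ 2 * ((1 / (2 * π)) ^ 2 * cosMoment F 0 0) = cosMoment F 0 0 := by field_simp
  rw [this] at h0
  exact hF h0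

/-- **The same on `Momentum`** (`evalM A q = A.eval (ofLp q)`). [cite: BenfattoGiulianiMastropietro2006, §3 (3.2)] -/
theorem exists_evalM_jacksonFrame_ne_zero {d : ℕ} {F : (Fin 2 → ℝ) → ℝ} (hF : cosMoment F 0 0 ≠ 0) :
    ∃ q : Momentum, evalM (jacksonFrame d F) q ≠ 0 := by
  obtain ⟨p, hp⟩ := exists_eval_jacksonFrame_ne_zero (d := d) hF
  exact ⟨WithLp.toLp 2 p, by simpa [evalM] using hp⟩

/-! ## §5 The G-005 shape -/

section Model

variable {L M : ℕ} [NeZero L] [NeZero M]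

/-- **G-005 «TADPOLE-NONVANISHING» REDUCED TO ONE NUMBER**: if the torus mean of the tube extension of the scale-0 local part (read at the bare frame `K₀ = 0`)
is nonzero, the scale-0 flow piece is not the zero function — the antecedent of `hresGuard_gfr_row_of_tadpole`. [cite: BenfattoGiulianiMastropietro2006, §3 (3.2)–(3.3)] -/
theorem exists_evalM_klFlowPiece_zero_ne_zero {β U μ : ℝ}
    (hmean : cosMoment (klFrameExtFn μ (fun θ => klLocalPart L M β U μ 0 0 θ)) 0 0 ≠ 0) :
    ∃ q : Momentum, evalM (klFlowPiece L M β U μ 0) q ≠ 0 := by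
  have h : klFlowPiece L M β U μ 0 = jacksonFrame (klFlowDeg 0) (klFrameExtFn μ (fun θ => klLocalPart L M β U μ 0 0 θ)) := by
    rw [klFlowPiece, klFlowFrameU_zero]; rfl
  rw [h]
  exact exists_evalM_jacksonFrame_ne_zero hmean

end Model

end Summit.HubbardSuperconductivity.HubbardSuperconductivity.Theorems.EngineV8

end
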